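/-
Origin: expansion seat `planner-pub-hodgecm-pv15-g2-0`, handover #12 2026-08-18T07:35:28Z (`HOME/pub-hodgecm-pv15-g2/lean/Pv15g2/KernelCompactTorusModel.lean`, md5 1c6c0cb6, 293 lines);
landed by the gen-7 packager in gate run 26 as `HodgeCM/Automorphic/KernelCompactTorusModel.lean` (import ^import Pv15g2\.→import HodgeCM.Automorphic. ×1; import ^import Pv[0-9]+g[0-9]+\.→import HodgeCM.PerL34. ×1).
-/
/-
Origin: HOME/pub-hodgecm-pv15-g2/lean/Pv15g2/KernelCompactTorusModel.lean — session planner-pub-hodgecm-pv15-g2-0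
(unit pub-hodgecm-pv15-g2, DAG-NODE PROVER #15 gen 2; lineage N23a → N23c, PerL v5 Prop 3.6 Step 2, ll. 405, 423–432).
Intended final place (packager's call): `HodgeCM/Automorphic/KernelCompactTorusModel.lean`.
NEW, ADDITIVE LEAF; imports my queued `Pv15g2.KernelCompactUnfold` (↦ `HodgeCM.Automorphic.KernelCompactUnfold`, run 26)
and pv06-g3's queued `Pv06g3.CompactTorusModel` (↦ `HodgeCM.PerL34.CompactTorusModel`, run 26, v2 md5 3eee5740d009).
KIND: KERNEL — complete proofs, no new axioms, nothing cited, nothing posited.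
-/
import Summits.HodgeConjecture.HodgeCM.Automorphic.KernelCompactUnfold
import Summits.HodgeConjecture.HodgeCM.PerL34.CompactTorusModel

/-!
# The Step-2 input of the kernel model over the compact quotient `[T] = T ⧸ Λ` — WITHOUT the field `unfold`

pv06-g3's `CompactTorusModelData ν C D` (`HodgeCM/PerL34/CompactTorusModel.lean`) is the genuine residual input of
PerL v5 Prop. 3.6 Step 2 over the compact quotient model of the torus: torus DATA, the archimedean block, the
identifications `Ew_eq`, `emb_surj`, `comm`, and two labelled propositions — `unfold` [AX12(ii)] and `dense` [PRINT].

For the THETA-KERNEL MODEL (`Dk : KernelTorusCarrier K T` over the cocompact Haar model `μQ = π_*(μ|𝓕_G)`, files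
`KernelCarrier` … `KernelCompactUnfold`) the proposition `unfold` is a THEOREM (`KernelTorusCarrier.unfold_holds_periodCLM`).
This file records the consequence at the level of pv06-g3's interface:

* §1 `KernelTorusCarrier.CompactInput Dk` — `CompactTorusModelData` for the kernel-model carrier with the torus, its
  measure and its embedding READ OFF the carrier (`T`, `Dk.ν`, `Dk.jT`), WITHOUT the field `unfold`, and with the two
  compatibility equations the kernel model needs instead: `β_sum` (the carrier's `β ∈ C_c(T(𝔸))` is a `T(L₀)`-partition of
  unity — PerL v5 l. 405 "`∫_{[T]} F = ∫_{T(𝔸)} β F dν`"; such `β` EXIST: `LatticePU.exists_partitionOfUnity`) and `emb_spec`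
  (the character `emb χ` of `[T]` IS the carrier's `χᵥ χ` — definitional);
* `CompactInput.toModelData : CompactTorusModelData μQ C D` with `unfold` PROVED, hence `toCompactTorusDatum`,
  `toQuotientTorusDatum` and `analyticK_of_compactInput : Dk.AnalyticK` (AX8 for the kernel model from the compact input);
* §2 the universe-level END STATE `Assembly.perL_ofKernelCompactInputs` / `COR_CM_endState_ofKernelCompactInputs`: as
  `perL_ofKernelModelData` but with, per context and torus side, a `CompactInput` (no `unfold`, no `fourier`, no `PT_cov`,
  no `res_spec` / `res_transl`) in place of a `QuotientTorusDatum`.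

NET: in the kernel model over compact quotient models NO analytic proposition of PerL §3.3 (AX1b, AX5b, AX8, AX9, AX12 in all
forms incl. [AX12(ii)] `unfold`, (U), `fourier`, `hatτ_complete`, `discreteDecomp`, `R_unitary`) is a hypothesis; what is left
per torus side is DATA + the identifications `Ew_eq`, `emb_spec`, `emb_surj`, `comm`, `β_sum` + `dense` [PRINT-DERIVED,
pv06-g2 `AnnihilationDense.dense_cosets_of_dictionary`], and globally `Structural` + first countability of `U(W)(𝔸)`.
-/

set_option autoImplicit false

noncomputable section

open MeasureTheory Set Filter Function Topology
open scoped InnerProductSpace CompactlySupported ComplexConjugate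

attribute [-instance] Quotient.instMeasurableSpace

namespace HodgeCM

open HodgeCM.PerL34 HodgeCM.PerL34.N23a HodgeCM.PerL34.Annihilation HodgeCM.PerL34.CompactTorusModel
  HodgeCM.PerL34.QuotientSmoothing HodgeCM.RegularRep

/-! ## §1  Carrier level -/

namespace KernelTorusCarrier

section CompactInput

variable {G : Type} [Group G] [TopologicalSpace G] [IsTopologicalGroup G] [T2Space G] [LocallyCompactSpace G]
  [MeasurableSpace G] [BorelSpace G]
variable {Γ : Subgroup G} [DiscreteTopology Γ] [IsClosed (Γ : Set G)] [MeasurableSpace (G ⧸ Γ)] [BorelSpace (G ⧸ Γ)]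
  [CompactSpace (G ⧸ Γ)]
variable {μQ : Measure (G ⧸ Γ)} [SMulInvariantMeasure G (G ⧸ Γ) μQ] [IsFiniteMeasure μQ]
variable {XU : Type} [TopologicalSpace XU] [CompactSpace XU]
variable {HG : Type} [NormedAddCommGroup HG] [InnerProductSpace ℂ HG] [CompleteSpace HG]
variable {SK SigIdxG : Type} [TopologicalSpace SK]
variable {K : KernelCoreCarrier G Γ μQ XU HG SK SigIdxG}
variable {T : Type} [CommGroup T] [TopologicalSpace T] [IsTopologicalGroup T] [T2Space T] [MeasurableSpace T] [BorelSpace T]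
variable (Dk : KernelTorusCarrier K T) [IsFiniteMeasureOnCompacts Dk.ν]

/-- **The Step-2 input of the kernel model over the compact quotient `[T] = T(𝔸) ⧸ T(L₀)`** — pv06-g3's
`CompactTorusModelData` with `T := T`, `νT := Dk.ν`, `jT := Dk.jT` and WITHOUT the field `unfold` [AX12(ii)] (a theorem of the
kernel model); instead the two compatibility equations `β_sum`, `emb_spec`. -/
structure CompactInput where
  /-- the rational points `T(L₀)`: a closed countable subgroup with compact quotient (Borel σ-algebra on the quotient) -/
  Λ : Subgroup T
  [instΛ₁ : Countable Λ]
  [instΛ₂ : IsClosed (Λ : Set T)]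
  [instQ₁ : MeasurableSpace (T ⧸ Λ)]
  [instQ₂ : BorelSpace (T ⧸ Λ)]
  [instQ₃ : CompactSpace (T ⧸ Λ)]
  /-- `T(L₀)` admits a fundamental domain of finite measure in `T(𝔸)` w.r.t. the carrier's `ν` (discrete cocompact `Λ`, locally
  compact `T`, `ν` finite on compacts: pv09-g4 `DiscreteFD.exists_isFundamentalDomain_op_finite'`) -/
  exists_fd : ∃ 𝓕 : Set T, IsFundamentalDomain Λ.op 𝓕 Dk.ν ∧ Dk.ν 𝓕 < ⊤
  /-- `jT (T(L₀)) ≤ U(W)(L₀)` -/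
  jT_Λ : Λ ≤ Γ.comap Dk.jT.toMonoidHom
  /-- [l. 405] the carrier's `β` is a `T(L₀)`-partition of unity: `∑_{a ∈ T(L₀)} β(t a) = 1` -/
  β_sum : ∀ t : T, ∑' a : Λ.op, (Dk.β (a • t) : ℂ) = 1
  /-- the compact group `T(L₀ ⊗ ℝ)` with its normalised Haar measure and its inclusion `ιc` into `T(𝔸)` -/
  Tc : Type
  [instTc₁ : Group Tc]
  [instTc₂ : TopologicalSpace Tc]
  [instTc₃ : IsTopologicalGroup Tc]
  [instTc₄ : CompactSpace Tc]
  [instTc₅ : MeasurableSpace Tc]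
  [instTc₆ : BorelSpace Tc]
  μ : Measure Tc
  [instμ₁ : IsProbabilityMeasure μ]
  [instμ₂ : μ.IsMulLeftInvariant]
  ιc : Tc →* T
  ιc_cont : Continuous ιc
  /-- the weight character `w = χ_∞|_{T(L₀⊗ℝ)}` of the isolated type, continuous and unitary -/
  w : Tc →* ℂ
  w_cont : Continuous w
  w_norm : ∀ t, ‖w t‖ = 1
  /-- [DEFINITIONAL] the torus side's weight space IS the joint eigenspace of `(jT ∘ ιc, w)` -/
  Ew_eq : Dk.toRegTorusCarrier.toRepTorusCarrier.Ew =
    RepDecomp.Ew K.toRegCoreCarrier.toRepCoreCarrier.R (Dk.jT.toMonoidHom.comp ιc) w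
  /-- the allowed characters among the characters of `[T] = T ⧸ Λ` … -/
  emb : Dk.X → PontryaginDual (T ⧸ Λ)
  /-- [DEFINITIONAL] … ARE the carrier's characters `χᵥ` -/
  emb_spec : ∀ (χ : Dk.X) (t : T), dualChar (emb χ) (QuotientGroup.mk t) = Dk.χv χ t
  /-- [DEFINITIONAL] ll. 425–427: a character of `[T]` with `ξ_∞ = w` is allowed -/
  emb_surj : ∀ ξ : PontryaginDual (T ⧸ Λ), (dualChar ξ).comp ((QuotientGroup.mk' Λ).comp ιc) = w → ∃ χ : Dk.X, emb χ = ξ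
  /-- the finite-adelic factor `U(W)(𝔸_f)`, commuting with the archimedean torus -/
  Gf : Type
  [instGf : Group Gf]
  ιf : Gf →* G
  comm : ∀ (hf : Gf) (t : Tc), ιf hf * Dk.jT (ιc t) = Dk.jT (ιc t) * ιf hf
  /-- [PRINT] `U(W)(L₀) · T(𝔸) · U(W)(𝔸_f)` is dense in `U(W)(𝔸)` (kernel supplement `AnnihilationDense`) -/
  dense : Dense {g : G | ∃ γ ∈ Γ, ∃ (t : T) (hf : Gf), g = γ * Dk.jT t * ιf hf}

attribute [instance] CompactInput.instΛ₁ CompactInput.instΛ₂ CompactInput.instQ₁ CompactInput.instQ₂ CompactInput.instQ₃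
  CompactInput.instTc₁ CompactInput.instTc₂ CompactInput.instTc₃ CompactInput.instTc₄ CompactInput.instTc₅
  CompactInput.instTc₆ CompactInput.instμ₁ CompactInput.instμ₂ CompactInput.instGf

namespace CompactInput

variable {Dk}
variable [Dk.ν.IsMulRightInvariant] [Dk.ν.IsOpenPosMeasure]

/-- **The builder: pv06-g3's `CompactTorusModelData` for the kernel model, with `unfold` [AX12(ii)] PROVED**
(`KernelTorusCarrier.unfold_holds_periodCLM` for `res := resCLM (resMap jT)` and EVERY fundamental domain `𝓕` of finite measure,
`μK := map π (ν|𝓕)`, in the cocompact Haar model `hM` of `[U(W)]`). -/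
def toModelData (I : Dk.CompactInput) {μ : Measure G} (hM : IsCocompactHaarModel Γ μQ μ) :
    CompactTorusModelData μQ K.toRegCoreCarrier.toRepCoreCarrier Dk.toRegTorusCarrier.toRepTorusCarrier where
  T := T
  Λ := I.Λ
  νT := Dk.ν
  exists_fd := I.exists_fd
  jT := Dk.jT.toMonoidHom
  jT_cont := Dk.jT.continuous
  jT_Λ := I.jT_Λ
  Tc := I.Tc
  μ := I.μ
  ιc := I.ιc
  ιc_cont := I.ιc_cont
  w := I.w
  w_cont := I.w_cont
  w_norm := I.w_norm
  Ew_eq := I.Ew_eq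
  emb := I.emb
  emb_surj := I.emb_surj
  Gf := I.Gf
  ιf := I.ιf
  comm := I.comm
  unfold := fun 𝓕 h𝓕 hlt x χ hx h => by
    haveI : IsFiniteMeasure (Measure.map (QuotientGroup.mk : T → T ⧸ I.Λ) (Dk.ν.restrict 𝓕)) :=
      isFiniteMeasure_map_restrict (Γ := I.Λ) Dk.ν hlt.ne
    have key := Dk.unfold_holds_periodCLM hM h𝓕
      (Measure.map (QuotientGroup.mk : T → T ⧸ I.Λ) (Dk.ν.restrict 𝓕)) rfl I.β_sum
      (resCLM (resMap Dk.jT.toMonoidHom Dk.jT.continuous I.jT_Λ)) (fun _ _ => rfl) I.emb I.emb_spec x χ hx h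
    rwa [periodCLM_apply] at key
  dense := I.dense

/-- pv06-g3's `CompactTorusDatum` for the kernel model (compact group `T ⧸ Λ`, measure `map π (ν|𝓕)`, `res`, `res_spec`,
`res_transl`, `PT_cov`, `fourier` AND `unfold` all constructed / proved). -/
def toCompactTorusDatum (I : Dk.CompactInput) {μ : Measure G} (hM : IsCocompactHaarModel Γ μQ μ) :
    CompactTorusDatum μQ K.toRegCoreCarrier.toRepCoreCarrier Dk.toRegTorusCarrier.toRepTorusCarrier :=
  (I.toModelData hM).toCompactTorusDatum

/-- … and the reduced `QuotientTorusDatum` consumed by `analyticK_of_quotientDatum` / `perL_ofKernelModelData`. -/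
def toQuotientTorusDatum (I : Dk.CompactInput) {μ : Measure G} (hM : IsCocompactHaarModel Γ μQ μ) :
    QuotientTorusDatum μQ K.toRegCoreCarrier.toRepCoreCarrier Dk.toRegTorusCarrier.toRepTorusCarrier :=
  (I.toCompactTorusDatum hM).toQuotient

end CompactInput

/-- **AX8 (Step 2 of PerL v5 Prop. 3.6) for the kernel-model torus carrier from the compact input** — no `unfold`, no
`fourier`, no smoothing data, no `R = ρHom` proviso among the hypotheses (first-countable `U(W)(𝔸)`, `hatτ_complete`). -/
theorem analyticK_of_compactInput [μQ.InnerRegularCompactLTTop] [FirstCountableTopology G]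
    [Dk.ν.IsMulRightInvariant] [Dk.ν.IsOpenPosMeasure]
    {μ : Measure G} (hM : IsCocompactHaarModel Γ μQ μ) (hτ : (⨆ j, K.hatτ j).topologicalClosure = ⊤)
    (I : Dk.CompactInput) : Dk.AnalyticK :=
  Dk.analyticK_of_quotientDatum hM hτ (I.toQuotientTorusDatum hM)

end CompactInput

end KernelTorusCarrier

/-! ## §2  Universe level: the END STATE with compact inputs -/

namespace Universe

namespace KernelModelThetaData

open HodgeCM.Prior.Perl34File HodgeCM.Prior.Perl34File.Perl34

variable {U : Universe} (D : U.KernelModelThetaData)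

/-- The extra structure a context's adelic torus `T(𝔸)` (typed in `KernelModelThetaData` as a bare topological measurable
group with a measure `ν`) must carry to form the compact quotient model: commutativity, topological-group and Borel structure,
and the Haar properties of `ν` (right invariant, positive on opens). -/
structure TorusCtx (T : Type) [Group T] [TopologicalSpace T] [MeasurableSpace T] (ν : Measure T) : Prop where
  mul_comm : ∀ a b : T, a * b = b * a
  topGroup : IsTopologicalGroup T
  borel : BorelSpace T
  rightInvariant : ν.IsMulRightInvariant
  openPos : ν.IsOpenPosMeasure

/-- the commutative group structure recorded by a `TorusCtx` (same multiplication). -/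
abbrev TorusCtx.commGroup {T : Type} [i : Group T] [TopologicalSpace T] [MeasurableSpace T] {ν : Measure T}
    (h : TorusCtx T ν) : CommGroup T :=
  { i with mul_comm := h.mul_comm }

/-- **Compact inputs for both torus sides of every context**: the torus structure `TorusCtx` and, in the resulting
commutative group, a `CompactInput` of the kernel-model torus carrier. -/
structure CompactInputs where
  ctx12 : ∀ {L : CMField} {ι₁ : L →+* ℂ} (V : HermSpace3 L ι₁) (c : SeesawCtx L), TorusCtx (D.T12 V c) (D.kt12 V c).ν
  ctx34 : ∀ {L : CMField} {ι₁ : L →+* ℂ} (V : HermSpace3 L ι₁) (c : SeesawCtx L), TorusCtx (D.T34 V c) (D.kt34 V c).ν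
  in12 : ∀ {L : CMField} {ι₁ : L →+* ℂ} (V : HermSpace3 L ι₁) (c : SeesawCtx L),
    letI : CommGroup (D.T12 V c) := (ctx12 V c).commGroup
    haveI := (ctx12 V c).topGroup
    haveI := (ctx12 V c).borel
    (D.kt12 V c).CompactInput
  in34 : ∀ {L : CMField} {ι₁ : L →+* ℂ} (V : HermSpace3 L ι₁) (c : SeesawCtx L),
    letI : CommGroup (D.T34 V c) := (ctx34 V c).commGroup
    haveI := (ctx34 V c).topGroup
    haveI := (ctx34 V c).borel
    (D.kt34 V c).CompactInput

/-- **`AnalyticKM` over models from the three structural laws and compact inputs** (first-countable `U(W)(𝔸)`). -/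
theorem analyticKM_of_compactInputs (hS : D.Structural)
    (hfc : ∀ {L : CMField} {ι₁ : L →+* ℂ} (V : HermSpace3 L ι₁) (c : SeesawCtx L),
      FirstCountableTopology (D.quot V c).G)
    (I : D.CompactInputs) : D.AnalyticKM :=
  D.analyticKM_of_quotientData hS hfc
    (fun {L} {ι₁} V c => by
      letI : CommGroup (D.T12 V c) := (I.ctx12 V c).commGroup
      haveI := (I.ctx12 V c).topGroup
      haveI := (I.ctx12 V c).borel
      haveI := (I.ctx12 V c).rightInvariant
      haveI := (I.ctx12 V c).openPos
      exact (I.in12 V c).toQuotientTorusDatum (D.quot V c).isCocompactHaarModel)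
    (fun {L} {ι₁} V c => by
      letI : CommGroup (D.T34 V c) := (I.ctx34 V c).commGroup
      haveI := (I.ctx34 V c).topGroup
      haveI := (I.ctx34 V c).borel
      haveI := (I.ctx34 V c).rightInvariant
      haveI := (I.ctx34 V c).openPos
      exact (I.in34 V c).toQuotientTorusDatum (D.quot V c).isCocompactHaarModel)

end KernelModelThetaData

end Universe

namespace Assembly

open HodgeCM.Prior.Perl34File HodgeCM.Prior.Perl34File.Perl34
open HodgeCM.Universe (KernelModelThetaData ThetaModel)

variable (U : Universe)

/-- **COR-CM, END STATE over MODELS, DATA and COMPACT INPUTS.**  As `COR_CM_endState_ofKernelModelData`, with the two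
`QuotientTorusDatum`s per context replaced by `CompactInputs` (no `unfold` [AX12(ii)], no `fourier`, no `PT_cov`, no
`res_spec` / `res_transl`: all theorems of the compact quotient model `[T] = T(𝔸) ⧸ T(L₀)` and of the kernel model). -/
theorem COR_CM_endState_ofKernelCompactInputs (M : U.ModelAxioms) (h29 : U.Fact_weightSpan)
    (h30 : U.Fact_weightHodge) (hE : U.Qw8ExtProd) (hD : U.Qw8DualPushPull) (hMi : U.Qw8Milne)
    (D : U.KernelModelThetaData) (hS : D.Structural)
    (hfc : ∀ {L : CMField} {ι₁ : L →+* ℂ} (V : HermSpace3 L ι₁) (c : SeesawCtx L),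
      FirstCountableTopology (D.quot V c).G)
    (I : D.CompactInputs)
    (A : (ThetaModel.ofRegCarrier D.toKernelThetaCarrier.toRegThetaCarrier
      (D.analyticKM_of_compactInputs hS hfc I).toAnalytic).Inputs)
    (hHR : U.Fact_hodgeRiemann20) : U.HC_CM :=
  COR_CM_endState_ofKernelModel U M h29 h30 hE hD hMi D (D.analyticKM_of_compactInputs hS hfc I) A hHR

/-- **PerL over models, data and compact inputs** (same hypotheses short of QW8 / the weight facts). -/
theorem perL_ofKernelCompactInputs (M : U.ModelAxioms) (D : U.KernelModelThetaData) (hS : D.Structural)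
    (hfc : ∀ {L : CMField} {ι₁ : L →+* ℂ} (V : HermSpace3 L ι₁) (c : SeesawCtx L),
      FirstCountableTopology (D.quot V c).G)
    (I : D.CompactInputs)
    (A : (ThetaModel.ofRegCarrier D.toKernelThetaCarrier.toRegThetaCarrier
      (D.analyticKM_of_compactInputs hS hfc I).toAnalytic).Inputs)
    (hHR : U.Fact_hodgeRiemann20) : U.PerL :=
  perL_ofKernelModel U M D (D.analyticKM_of_compactInputs hS hfc I) A hHR

end Assembly

end HodgeCM

end
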